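import Summits.QuantumFields.YangMills.Theorems.InfiniteVolumeTorusScheme
import Summits.QuantumFields.YangMills.Theorems.InfiniteVolumeTranslations
import HarnessLib

/-!
# Infinite volume by compactness, step 7: the «`L → ∞` first, then `a → 0`» continuum-data candidates, packaged —
# ONE subsequence, limit functionals with the E0′ bound, translation invariance, AND realisation as limits along a
# torus species scheme of the spine with sides above any growth demand

HONEST FRAMING (cell `ym-fleet`, seat `ym-infvol-p2`, director-ym R136 (i) «INFINITE-VOLUME ∕ CONTINUUM-FROM-UV
ROUTE», pre-birth helper; bears on LADDER-YM R1∕R2a).  Pure soft analysis, kernel-checked; NOTHING here is a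
statement about Bałaban's renormalisation group, rotations ∕ reflection positivity ∕ clustering of the limit,
uniqueness of the infinite-volume state, a mass gap, or Clay.  The only Yang–Mills-specific input type is the
spine's UV-leg currency `MomentBounds6 G r a` (HYPOTHESIS).  This file only ASSEMBLES steps 1–6.

THE PACKAGE (`exists_continuumData_oddTorusLimitPoints`).  From `MomentBounds6 G r a`: thresholds `β₀`, `ℓ₀ > 0` and
ONE constant `K ≥ 0` such that for EVERY coupling sequence `β_k ≥ β₀` with `0 < a(β_k) ≤ min (1/24) ℓ₀` and
`a(β_k) → 0`, EVERY choice of thermodynamic limit states `μ_k ∈ oddTorusLimitPoints r (β_k)` of the torus-projective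
family, and EVERY growth demand `g : ℕ → ℕ`, there are
* torus sides `L_k ≥ g k` (also `≥ 14`, `≥ a(β_k)⁻²`) — a torus species scheme `(β_k, L_k, a(β_k))` of the spine,
* ONE strictly increasing `φ`, and continuous linear functionals `S n q` on `𝓢((Fin n → E4), ℂ)` with
  `‖S n q F‖ ≤ 5Kⁿ·‖F‖_{10n}` everywhere,
such that for every `n ≥ 2`, valid plane string `q` and `F ∈ ⁰𝒮ₙ`:
(i) the infinite-volume series `Σ'ₓ W_{μ_{φ j}}(q,x)·F(a_{φ j}·x) → S n q F` (continuum limit of the infinite-volume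
lattice states — the «`L → ∞` first» order of limits);
(ii) the spine's torus distributions `latticeDistStr r.ρ β_{φ j} L_{φ j} a_{φ j} (planes q) (means) F → S n q F`
(the SAME functionals are limits along the torus species scheme, so torus-scheme legs — `ROT`'s `LatticeRotWard`,
the RP ∕ hypercubic toolkits — address them);
(iii) `S n q (translateMulti t F) = S n q F` for all `t ∈ E4` (translation half of E1).

References: Glimm–Jaffe (1987) §6.1; Osterwalder–Schrader CMP 42 (1975) §§2, 4; Chatterjee arXiv:1803.01950 §§2, 5.
-/

set_option autoImplicit false

noncomputable section

open scoped BigOperators SchwartzMap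
open MeasureTheory Filter Topology
open Literature.MathematicalPhysics.QuantumFieldTheory hiding ZdEdge
open Literature.MathematicalPhysics.QuantumLattice
open Literature.MathematicalPhysics.AQFT
open Literature.Probability.LatticeModels (box Site)
open Summit.QuantumFields.YangMills.Cruxes.OSLegsFromFemtoAndGap.DlrCollarTransfer
  (plane torusE MomentBounds6 exists_abs_plane_le)
open Summit.QuantumFields.YangMills.Theorems.OSLegsFromFemtoAndGap (torusMomentStr latticeDistStr)

namespace Summit.QuantumFields.YangMills.Theorems.InfiniteVolume

variable {G : Type} [Group G] [TopologicalSpace G] [IsTopologicalGroup G] [CompactSpace G]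
  [MeasurableSpace G] [BorelSpace G]

/-- **THE «`L → ∞` FIRST, THEN `a → 0`» CONTINUUM-DATA CANDIDATES, PACKAGED** (module docstring): one subsequence,
limit functionals with the E0′ bound, (i) continuum limit of the infinite-volume states, (ii) the same functionals
as limits of the spine's torus distributions along a torus species scheme with sides above any growth demand,
(iii) translation invariance.  Assembly of steps 2–6 (`exists_torusSides_approximating`,
`exists_subseq_limit_oddTorusLimitPoints`, `translateMulti_invariant_of_tendsto_oddTorusLimitPoints`). [folklore] -/
theorem exists_continuumData_oddTorusLimitPoints (r : LatticeRep G) {a : ℝ → ℝ} (hMB : MomentBounds6 G r a) :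
    ∃ (β₀ ℓ₀ K : ℝ), 0 < ℓ₀ ∧ 0 ≤ K ∧
      ∀ (β : ℕ → ℝ), (∀ k, β₀ ≤ β k) → (∀ k, 0 < a (β k)) → (∀ k, a (β k) ≤ 1 / 24) → (∀ k, a (β k) ≤ ℓ₀) →
        Tendsto (fun k => a (β k)) atTop (𝓝 0) →
      ∀ (μ : ℕ → Measure (LGConfig 4 G)), (∀ k, μ k ∈ oddTorusLimitPoints r (β k)) →
      ∀ g : ℕ → ℕ, ∃ L : ℕ → ℕ, (∀ k, g k ≤ L k) ∧ (∀ k, 14 ≤ L k ∧ (a (β k))⁻¹ * (a (β k))⁻¹ ≤ (L k : ℝ)) ∧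
        ∃ φ : ℕ → ℕ, StrictMono φ ∧
        ∃ S : (n : ℕ) → (Fin n → Fin 4 × Fin 4) → (𝓢((Fin n → EuclideanSpace ℝ (Fin 4)), ℂ) →L[ℂ] ℂ),
          (∀ n q F, ‖S n q F‖ ≤ 5 * K ^ n * schwartzNorm (10 * n) F) ∧
          ∀ n : ℕ, 2 ≤ n → ∀ q : Fin n → Fin 4 × Fin 4, (∀ i, (q i).1 < (q i).2) →
            ∀ F : 𝓢((Fin n → EuclideanSpace ℝ (Fin 4)), ℂ), IsOffDiagonal F →
              Tendsto (fun j => ∑' x : Fin n → Site 4,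
                (((∫ U, ∏ i, (plane G r (q i) (x i) U - ∫ V, plane G r (q i) (x i) V ∂(μ (φ j))) ∂(μ (φ j)) : ℝ)
                  : ℂ)) * F (fun l => a (β (φ j)) • siteToE (x l))) atTop (𝓝 (S n q F)) ∧
              Tendsto (fun j => latticeDistStr r.ρ (β (φ j)) (L (φ j)) (a (β (φ j)))
                (fun i U => plaquetteObs r.ρ 0 (q i).1 (q i).2 U)
                (fun i => wilsonTorusMean r.ρ (β (φ j)) (L (φ j)) (fun U => plaquetteObs r.ρ 0 (q i).1 (q i).2 U)) F)
                atTop (𝓝 (S n q F)) ∧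
              ∀ t : EuclideanSpace ℝ (Fin 4), S n q (translateMulti t F) = S n q F := by
  -- constants of the three ingredients
  obtain ⟨C, β₄, ℓ₄, hℓ, hC, Hcol⟩ := hMB
  have hMB' : MomentBounds6 G r a := ⟨C, β₄, ℓ₄, hℓ, hC, Hcol⟩
  obtain ⟨β₁, ℓ₁, hℓ₁, Hjun⟩ := exists_torusSides_approximating r hMB'
  obtain ⟨β₂, ℓ₂, K, hℓ₂, hK, Hcpt⟩ := exists_subseq_limit_oddTorusLimitPoints r hMB'
  refine ⟨max β₄ (max β₁ β₂), min ℓ₄ (min ℓ₁ ℓ₂), K, lt_min hℓ (lt_min hℓ₁ hℓ₂), hK, ?_⟩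
  intro β hβ ha ha24 haℓ ha0 μ hμ g
  have hβ₄ : ∀ k, β₄ ≤ β k := fun k => le_trans (le_max_left _ _) (hβ k)
  have hβ₁' : ∀ k, β₁ ≤ β k := fun k => le_trans (le_trans (le_max_left _ _) (le_max_right _ _)) (hβ k)
  have hβ₂' : ∀ k, β₂ ≤ β k := fun k => le_trans (le_trans (le_max_right _ _) (le_max_right _ _)) (hβ k)
  have hℓ₄' : ∀ k, a (β k) ≤ ℓ₄ := fun k => (haℓ k).trans (min_le_left _ _)
  have hℓ₁' : ∀ k, a (β k) ≤ ℓ₁ := fun k => (haℓ k).trans ((min_le_right _ _).trans (min_le_left _ _))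
  have hℓ₂' : ∀ k, a (β k) ≤ ℓ₂ := fun k => (haℓ k).trans ((min_le_right _ _).trans (min_le_right _ _))
  -- torus sides from the junction
  obtain ⟨L, hLg, hL14, -, hLconv⟩ := Hjun β hβ₁' ha ha24 hℓ₁' μ hμ g
  -- the subsequence and the limits of the infinite-volume functionals (base points: offsets `0`)
  have hy : ∀ k n (q : Fin n → Fin 4 × Fin 4) (x : Fin n → Site 4) l,
      ‖(fun l => a (β k) • siteToE (x l)) l - a (β k) • siteToE (x l)‖ ≤ 6 * a (β k) := fun k n q x l => by
    rw [sub_self, norm_zero]; exact mul_nonneg (by norm_num) (ha k).le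
  obtain ⟨φ, hφ, S, hS, hconv⟩ := Hcpt β hβ₂' ha ha24 hℓ₂' μ hμ (fun k n q x l => a (β k) • siteToE (x l)) hy
  refine ⟨L, hLg, hL14, φ, hφ, S, hS, fun n hn q hq F hF => ⟨hconv n hn q hq F hF, ?_, fun t => ?_⟩⟩
  · -- (ii): torus distributions minus infinite-volume series → 0 along `φ`, and the latter → `S n q F`
    have h0 := (hLconv n hn q hq F hF).comp hφ.tendsto_atTop
    have h1 := hconv n hn q hq F hF
    have h2 := h0.add h1
    rw [zero_add] at h2
    refine h2.congr fun j => ?_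
    simp only [Function.comp_apply, sub_add_cancel]
  · -- (iii): translations (step 4), offsets `0`
    have ho : ∀ (k : ℕ) (l : Fin n), ‖(fun _ : Fin n => (0 : EuclideanSpace ℝ (Fin 4))) l‖ ≤ 5 * a (β k) :=
      fun k l => by rw [norm_zero]; exact mul_nonneg (by norm_num) (ha k).le
    have hconv' : ∀ F' : 𝓢((Fin n → EuclideanSpace ℝ (Fin 4)), ℂ), IsOffDiagonal F' →
        Tendsto (fun j => ∑' x : Fin n → Site 4,
          (((∫ U, ∏ i, (plane G r (q i) (x i) U - ∫ V, plane G r (q i) (x i) V ∂(μ (φ j))) ∂(μ (φ j)) : ℝ)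
            : ℂ)) * F' (fun l => a (β (φ j)) • siteToE (x l) + (fun _ : Fin n => (0 : EuclideanSpace ℝ (Fin 4))) l))
          atTop (𝓝 (S n q F')) := fun F' hF' => by
      simpa only [add_zero] using hconv n hn q hq F' hF'
    exact translateMulti_invariant_of_tendsto_oddTorusLimitPoints r hℓ hC Hcol β hβ₄ ha ha24 hℓ₄' ha0 μ hμ hn q hq
      (fun _ _ => 0) ho hφ (S n q) hconv' t F hF

end Summit.QuantumFields.YangMills.Theorems.InfiniteVolume

end
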